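import Literature.Barriers.ValiantsHypothesis.BIJL18PermanentZeroDivisibilityProofs
import Literature.Computability.AlgebraicComplexity.RealTauConjectureDepthFour
import Literature.Computability.AlgebraicComplexity.ValiantConjectureProofs
import Literature.Computability.AlgebraicComplexity.RazElusiveGeneralRouteProofs
import Literature.Computability.AlgebraicComplexity.PermanentVNP0
import HarnessLib

/-!
# Bläser–Ikenmeyer–Jindal–Lysikov 2018, §6 — the factor-closure shadow of Thm. 6:
# with Kaltofen's theorem, `VP⁰`-natural proofs against `{Per = 0}` put `Per` in `VP_ℚ`

Theorem-only companion of `BIJL18PermanentZero.lean` / `BIJL18PermanentZeroDivisibilityProofs.lean`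
(val-lit cell, seat t23). Source: [BlaserIkenmeyerJindalLysikov2018] §6 (ECCC TR18-064 pp.17–19),
Thm. 6: "If there are `VP⁰`-natural proofs over characteristic zero against the set of matrices with
permanent zero, then `P^{#P} ⊆ ∃BPP`", proved by guessing the natural proof `D_k`, checking
`D_k(Z_k(X)) = 0`, concluding `D_k = Per_k^e · h` (step 4) and FACTORING (step 6, Kaltofen over `𝔽_p`,
Thm. 24).

**What this file proves.** The algebraic consequence of the same steps that the tree can state
without randomised machines: by `hasVP0NaturalProofsAgainstPerZero_iff_perPoly_dvd` (sibling file)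
a `VP⁰`-natural proof family consists of nonzero multiples `D_n` of `Per_n` of p-bounded
(constant-free) size and degree; Kaltofen's factor bound — the tree's NAMED FACT
`KaltofenFactorBound ℚ` [Burgisser2024Completeness, Thm. 3.2 / Cor. 3.3: "`VP` is closed under
taking factors"], taken as a HYPOTHESIS — then bounds `L_ℚ(Per_n) ≤ (L(D_n) + deg D_n + 2)^κ`, so
the permanent family is p-computable over `ℚ` with constants
(`isPComputable_perPoly_rat_of_hasVP0NaturalProofsAgainstPerZero`) and lies in `VP_ℚ`
(`isVPFamily_perPoly_rat_of_hasVP0NaturalProofsAgainstPerZero`).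

HONEST FRAMING. This is NOT the printed Thm. 6: its conclusion is algebraic (`Per ∈ VP` over `ℚ`,
circuits WITH constants — whence BIJL's detour through `𝔽_p` to stay constant-free) rather than
Boolean (`P^{#P} ⊆ ∃BPP`), and it is conditional on the tree's open Kaltofen fact. Nothing here
discharges `BIJL2018_thm5`/`BIJL2018_thm6`; no named fact is introduced; `VP ≠ VNP` is NOT proved
and nothing here is progress on it.
-/

noncomputable section

namespace Literature.Barriers.ValiantsHypothesis

open MvPolynomial Literature.Computability.AlgebraicComplexity

/-! ### (e) The factor-closure shadow: with Kaltofen, `VP⁰`-natural proofs put `Per` in `VP_ℚ` -/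

section FactorClosure

open PerZeroDivisibility

/-- Base change does not increase the total degree (plumbing). [folklore] -/
private theorem totalDegree_map_le_aux {R S σ : Type*} [CommSemiring R] [CommSemiring S]
    (f : R →+* S) (p : MvPolynomial σ R) : (map f p).totalDegree ≤ p.totalDegree :=
  Finset.sup_mono (support_map_subset f p)

/-- **The factor-closure shadow of Thm. 6.** If there are `VP⁰`-natural proofs against the set of
matrices with permanent zero (`HasVP0NaturalProofsAgainstPerZero`, the typed hypothesis of
`BIJL2018_thm6`), then — granted Kaltofen's theorem that factors of polynomials with small circuits
have small circuits (the tree's named fact `KaltofenFactorBound ℚ`, Bürgisser 2024 Thm. 3.2 /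
Cor. 3.3: "`VP` is closed under taking factors") — the permanent family is p-computable over `ℚ`
(circuits WITH constants): by `hasVP0NaturalProofsAgainstPerZero_iff_perPoly_dvd` the natural
proofs `D_n ≠ 0` are multiples of `Per_n`, of p-bounded constant-free size and degree, and
`L_ℚ(Per_n) ≤ (L(D_n) + deg D_n + 2)^κ`. This is NOT the printed Thm. 6 (whose conclusion
`P^{#P} ⊆ ∃BPP` is Boolean and whose proof stays constant-free by factoring over `𝔽_p`, Thm. 24);
it is the derived algebraic consequence available in the tree, recorded next to it.
[cite: BlaserIkenmeyerJindalLysikov2018, §6 (Thm. 6; proof of Thm. 5, steps 4–6)] locator: ECCC pp.17–19;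
[cite: Burgisser2024Completeness, Thm. 3.2] -/
theorem isPComputable_perPoly_rat_of_hasVP0NaturalProofsAgainstPerZero
    (hK : KaltofenFactorBound ℚ) (h : HasVP0NaturalProofsAgainstPerZero) :
    IsPComputable (fun n => perPoly (Fin n) ℚ) := by
  obtain ⟨κ, hκ⟩ := hK
  obtain ⟨D, hVP, hD⟩ := hasVP0NaturalProofsAgainstPerZero_iff_perPoly_dvd.1 h
  have hs : IsPBounded fun n => constantFreeComplexity (D n) :=
    hVP.isPBounded_constantFreeComplexity
  have hd : IsPBounded fun n => (D n).totalDegree := hVP.isPFamily.2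
  refine (IsPBounded.pow_holds (IsPBounded.add_holds (IsPBounded.add_holds hs hd)
    (IsPBounded.const 2)) κ).mono fun n => ?_
  -- transport to `Fin (n·n)` variables, where Kaltofen's bound is stated
  set D' : MvPolynomial (Fin n × Fin n) ℚ := map (Int.castRingHom ℚ) (D n) with hD'
  have hD'0 : D' ≠ 0 := by
    intro h0
    apply (hD n).1
    apply map_injective (Int.castRingHom ℚ) Int.cast_injective
    rw [map_zero]
    exact h0
  set e : Fin n × Fin n ≃ Fin (n * n) := finProdFinEquiv with he
  have hne : rename e D' ≠ 0 := (map_ne_zero_iff _ (rename_injective _ e.injective)).2 hD'0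
  have hdvd : rename e (perPoly (Fin n) ℚ) ∣ rename e D' := map_dvd _ (hD n).2
  have hk := hκ (n * n) (rename e D') (rename e (perPoly (Fin n) ℚ)) hne hdvd
  have hper : complexity (rename e (perPoly (Fin n) ℚ)) = complexity (perPoly (Fin n) ℚ) :=
    complexity_renameEquiv_holds e (perPoly (Fin n) ℚ)
  have hDe : complexity (rename e D') = complexity D' := complexity_renameEquiv_holds e D'
  rw [hper] at hk
  refine hk.trans (Nat.pow_le_pow_left ?_ κ)
  have h1 : complexity (rename e D') ≤ constantFreeComplexity (D n) :=
    hDe.le.trans (ArithCircuit.complexity_map_le_constantFreeComplexity _ _)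
  have h2 : (rename e D').totalDegree ≤ (D n).totalDegree :=
    (totalDegree_rename_le _ _).trans (totalDegree_map_le_aux _ _)
  omega

/-- **Corollary: under `KaltofenFactorBound ℚ`, `VP⁰`-natural proofs against `{Per = 0}` put the
permanent family in `VP` over `ℚ`** (`IsVPFamily`: p-family + p-computable; the p-family half is
the tree's `isPFamily_perPoly_holds`). Derived consequence recorded next to the LOAD-BEARING fact
`BIJL2018_thm6`; not the printed (Boolean, constant-free) statement.
[cite: BlaserIkenmeyerJindalLysikov2018, §6 (Thm. 6)] locator: ECCC pp.17–19;
[cite: Burgisser2024Completeness, Cor. 3.3] -/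
theorem isVPFamily_perPoly_rat_of_hasVP0NaturalProofsAgainstPerZero
    (hK : KaltofenFactorBound ℚ) (h : HasVP0NaturalProofsAgainstPerZero) :
    IsVPFamily (fun n => perPoly (Fin n) ℚ) := by
  refine ⟨?_, isPComputable_perPoly_rat_of_hasVP0NaturalProofsAgainstPerZero hK h⟩
  have hpf := @isPFamily_perPoly_holds ℚ
  unfold isPFamily_perPoly at hpf
  exact hpf

/-- **Over `ℂ`.** The same consequence after extension of scalars `ℚ → ℂ` (free:
`ArithCircuit.complexity_map_le`, `map_perPoly`): under `KaltofenFactorBound ℚ`, `VP⁰`-natural proofs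
against `{Per = 0}` make the permanent family p-computable over `ℂ`.
[cite: BlaserIkenmeyerJindalLysikov2018, §6 (Thm. 6)] locator: ECCC pp.17–19;
[cite: Burgisser2024Completeness, Cor. 3.3] -/
theorem isPComputable_perPoly_complex_of_hasVP0NaturalProofsAgainstPerZero
    (hK : KaltofenFactorBound ℚ) (h : HasVP0NaturalProofsAgainstPerZero) :
    IsPComputable (fun n => perPoly (Fin n) ℂ) := by
  obtain ⟨c, hc⟩ := isPComputable_perPoly_rat_of_hasVP0NaturalProofsAgainstPerZero hK h
  refine ⟨c, fun n => le_trans ?_ (hc n)⟩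
  show complexity (perPoly (Fin n) ℂ) ≤ complexity (perPoly (Fin n) ℚ)
  rw [← map_perPoly (n := Fin n) (algebraMap ℚ ℂ)]
  exact ArithCircuit.complexity_map_le _ _

/-- **The barrier in Valiant-hypothesis form.** Granted Kaltofen's factor closure
(`KaltofenFactorBound ℚ`), Valiant's hypothesis over `ℂ` ITSELF — in the tree's equivalent form
`PerNotPComputableComplex` ("the permanent family is not p-computable over `ℂ`", an open conjecture
used here only as a HYPOTHESIS) — rules out `VP⁰`-natural proofs against the set of matrices with
permanent zero. BIJL's Thm. 6 is the variant with the Boolean hypothesis `P^{#P} ⊄ ∃BPP` in place of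
Valiant's hypothesis (and with no factor-closure hypothesis, by factoring over `𝔽_p`); the paper's
remark "Note that this set has a `VNP⁰`-natural proof, namely the permanent itself" (ECCC p.17) is
the other side of the same coin. Derived consequence, recorded next to the LOAD-BEARING fact; not a
printed statement of [BIJL18]. [cite: BlaserIkenmeyerJindalLysikov2018, §6 (Thm. 6 and p.17)]
locator: ECCC pp.17–19; [cite: Burgisser2024Completeness, Cor. 3.3] -/
theorem not_hasVP0NaturalProofsAgainstPerZero_of_perNotPComputableComplex
    (hK : KaltofenFactorBound ℚ) (hV : PerNotPComputableComplex) :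
    ¬ HasVP0NaturalProofsAgainstPerZero :=
  fun h => hV (isPComputable_perPoly_complex_of_hasVP0NaturalProofsAgainstPerZero hK h)

/-- **"Note that this set has a `VNP⁰`-natural proof, namely the permanent itself"** (ECCC p.17):
the `VNP⁰` analogue of `HasVP0NaturalProofsAgainstPerZero` holds unconditionally, witnessed by
`D_n = Per_n` (`isVNP0Family_perPoly`; `Per_n ≠ 0`; `Per_n(A) = per A = 0` on the set).
[cite: BlaserIkenmeyerJindalLysikov2018, §6 (p. 17)] locator: ECCC p.17 -/
theorem hasVNP0NaturalProofsAgainstPerZero :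
    ∃ D : ∀ n : ℕ, MvPolynomial (Fin n × Fin n) ℤ, IsVNP0Family D ∧
      ∀ n, D n ≠ 0 ∧ ∀ A : Matrix (Fin n) (Fin n) ℚ, A.permanent = 0 →
        aeval (fun ij : Fin n × Fin n => A ij.1 ij.2) (D n) = 0 := by
  refine ⟨fun n => perPoly (Fin n) ℤ, isVNP0Family_perPoly, fun n => ⟨perPoly_ne_zero _ _, ?_⟩⟩
  intro A hA
  have hper : eval (fun v : Fin n × Fin n => A v.1 v.2) (perPoly (Fin n) ℚ) = A.permanent := by
    rw [eval_perPoly]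
    rfl
  rw [aeval_def, algebraMap_int_eq, ← eval_map, map_perPoly, hper, hA]

end FactorClosure

end Literature.Barriers.ValiantsHypothesis

end
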